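import Summits.QuantumFields.YangMills.Theorems.BalabanUVNodesN15KingModelAnalyticCoercive
import HarnessLib

/-!
# BalabanUVNodes ∕ N15 — THE KING-MODEL RUNG (PART Ϩ-f): PRINT's `Gᶜ` SLICE `V = U⁻¹` HAS A SECOND-ORDER DEFECT — for `‖U_b − U₀_b‖ ≤ ε ≤ ½` (unitary `U₀`, ANY complex `U`) the pair
# `(U, U⁻¹)` is `(2ε, 2ε²)`-near `U₀`; hence on the slice the window of PART Ϩ-e is BAŁABAN's SCALE `Lε = s = O(1)`: invertibility of `A(U,U⁻¹)`, `‖G(U,U⁻¹)‖ ≤ 4∕κ` and the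
# exponential decay `‖blk G(U,U⁻¹) x y‖ ≤ (8∕κ)e^{−ctRate(κ∕2,a,d)d(x,y)∕L}` under budgets POLYNOMIAL IN `s` (vs the two-sided family: linear in `L·(Lε)`, i.e. `O(η²)`, PART Ϛ-d sharp)
# (Track A, DAG node N15 = NE2; FAN-OUT v1.1 §N15 s3 «KING-MODEL RUNG … + what the curved case adds»; count-neutral)

HONEST FRAMING.  Count-neutral (cell `pub-ymgap`, seat `pub-ymgap-dag-n15-e` g51; `--supports stmt-QuantumFields-27247 --as helper` = K3ᴬ, KEY MAP v3).  King's one-level comparison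
model; PART Ϩ-e's master estimate specialised to print's complexification `U ↦ A(U,U⁻¹)` of [B9] §3.B («extend the operators to configurations with values in the complexified group
Gᶜ» — here `GL(n,ℂ)`-valued bond variables near a unitary field; `U⁻¹` is Mathlib's matrix inverse, a genuine inverse on the window).  NOT Bałaban's multi-level `G_k(U)`; NOT a node
discharge (N15 of record untouched); nothing continuum ∕ ℝ⁴ ∕ OS ∕ Clay.

THE RESULTS:
* §1 ONE BOND (unitary `a`, ANY `u` with `‖u − a‖ ≤ ε < 1`; `X = aᴴ(u − a)`, `u = a(1+X)`, `Y = (1+X)⁻¹ = 1 − XY`): `isUnit_one_add_of_norm_lt_one`, ★ `isUnit_of_near_unitary` (`u` invertible),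
  `norm_inv_one_add_le` (`‖(1+X)⁻¹‖ ≤ (1−ε)⁻¹`), ★★ **`norm_inv_sub_conjTranspose_le_of_near_unitary`** (`‖u⁻¹ − aᴴ‖ ≤ ε∕(1−ε)`), ★★★ **`norm_slice_zeroth_le`** (THE SLICE DEFECT IS SECOND ORDER:
  `(u−a)aᴴ + a(u⁻¹−aᴴ) = aX²Yaᴴ`, `‖·‖ ≤ ε²∕(1−ε)` — the first-order terms `aXaᴴ − aXaᴴ` CANCEL; compare two-sided `2ε` (Ϩ-c) and unitary `ε²` (Ϩ-c)).
* §2 FIELDS with `‖U_b − U₀_b‖ ≤ ε ≤ ½`: `slice_near_fwd` (`≤ 2ε`), ★ `slice_near_bwd` (`‖U_b⁻¹ − U₀_bᴴ‖ ≤ 2ε`), ★★ `slice_near_zeroth` (`≤ 2ε²`) — `(U,U⁻¹)` is `(2ε, 2ε²)`-near `U₀`.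
* §3 KING's SCALING ON THE SLICE (`c = L²`, `L ≥ 1`, `a, m² ≥ 0`, unitary `U₀` with `κ`-coercive `A₀(U₀)`, contours of depth `≤ D`, `s = Lε`):
  ★★★ **`isUnit_cxFullOp_slice`**, ★★★ **`l2_opNorm_cxFullOp_inv_slice_le`** (`10(d+1)s² + a((1+2ε)^{2D} − 1) ≤ κ∕4` ⟹ `A(U,U⁻¹)` invertible, `‖G(U,U⁻¹)‖ ≤ 4∕κ`),
  ★★★★ **`norm_blk_cxFullOp_inv_slice_le`** (`(d+1)(e(2s² + 4s) + 8e²s²) + e·a((1+2ε)^{2D} − 1) ≤ κ∕8` ⟹ `‖blk G(U,U⁻¹) x y‖ ≤ (8∕κ)e^{−ctRate(κ∕2,a,d)·d(x,y)∕L}`),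
  ★★★ `re_quadForm_cxFullOp_slice_ge` (the coercivity constant itself).  With the comb (`D = (d+1)(L−1)`) `(1+2ε)^{2D} ≤ e^{4(d+1)s}`: ALL BUDGETS ARE FUNCTIONS OF `s = Lε = ε∕η` AND `(κ,a,d)`
  ONLY — PART Ϩ-g extracts the explicit radius `s₀(κ,a,d)`.
* §4 FOR COMPARISON: ★ `isUnit_cxFullOp_two_sided` (independent `(U,V)` `ε`-near: budget `(d+1)(2L²ε + 2(Lε)²) + a(…) ≤ κ∕4` — LINEAR in `L²ε`: the `O(η²)` window of PART Ϛ), ★★ `re_quadForm_fullOpU_ge_of_near_unitary`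
  (UNITARY `U` near `U₀`: `(κ∕2 − 3(d+1)(Lε)² − a((1+ε)^{2D}−1))N ≤ Re⟨ω,A₀(U)ω⟩` — COERCIVITY IS AN OPEN CONDITION ON BAŁABAN's SCALE: the small-curvature∕pure-gauge floors of PART Ϥ propagate to
  `s₀η`-neighbourhoods WITHOUT re-deriving them at `U`).
PRIOR TREE ART (by name): Ϩ-e (`re_quadForm_cxFullOp_ge`, `isUnit_cxFullOp_of_near`, `l2_opNorm_cxFullOp_inv_le_of_near`, `isUnit∕l2_opNorm∕norm_blk_cxFullOp_…_king_of_near`), Ϩ-c (`zeroth_unitary_slice`,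
`norm_zeroth_two_sided_le`), Ϩ-a (`cxFullOp_adjoint`), Ϧ-c (`ctRate`), Ͱ-q (`l2_opNorm_of_mem_unitaryGroup_le`), Mathlib (`Units.oneSub`, `Matrix.mul_inv_rev`, `Matrix.nonsing_inv_mul`).
Dedup (rg at filing): basename 0 files; needles `norm_slice_zeroth_le|isUnit_of_near_unitary|cxFullOp_slice|slice_near_` 0 tree files.  presearch: n/a (elementary Neumann-series algebra on one bond
+ specialisation of Ϩ-e).  Locators: [Balaban1985BackgroundPropagators] §3.B p.399 l.37–40, Thm 3.4 p.400 («for α₁ ≤ a₁ … a positive constant a₁»), (3.48)–(3.53) pp.398–400, Thm 3.1 p.397;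
[King1986] (4.33) p.674.  0 `sorry`, 0 `def`.
-/

noncomputable section
open scoped BigOperators ComplexConjugate ComplexOrder InnerProductSpace Matrix.Norms.L2Operator
open Finset Matrix WithLp

namespace Summit.QuantumFields.YangMills.BalabanUVNodes.N15KingModelRung.Analytic

open Literature.MathematicalPhysics.QuantumFieldTheory.LatticeDiamagneticInequality (blk)
open Literature.MathematicalPhysics.QuantumFieldTheory.Balaban1983to89.B5Prop11Plancherel (Tor fine unitVec)
open Literature.MathematicalPhysics.QuantumFieldTheory.King1986.Torus (tdistT)
open Summit.QuantumFields.YangMills.BalabanUVNodes.N15KingModelRung.Covariant (fib l2_opNorm_of_mem_unitaryGroup_le)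
open Summit.QuantumFields.YangMills.BalabanUVNodes.N15KingModelRung.CovariantBlock (BlockTree fullOpU)
open Summit.QuantumFields.YangMills.BalabanUVNodes.N15KingModelRung.CombesThomas (ctRate)

variable {𝕜 : Type*} [RCLike 𝕜] {n : Type*} [Fintype n] [DecidableEq n]

/-! ## §1 One bond: the slice defect is second order -/

section OneBond

/-- `‖X‖ < 1 ⟹ 1 + X` is invertible (Neumann series; `Matrix n n 𝕜` with the `ℓ²` operator norm is a complete normed ring). [folklore] -/
theorem isUnit_one_add_of_norm_lt_one {X : Matrix n n 𝕜} (hX : ‖X‖ < 1) : IsUnit (1 + X) := by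
  haveI : CompleteSpace (Matrix n n 𝕜) := FiniteDimensional.complete 𝕜 _
  have h := (Units.oneSub (-X) (by rwa [norm_neg])).isUnit
  rwa [Units.val_oneSub, sub_neg_eq_add] at h

/-- `‖X‖ ≤ ε < 1 ⟹ ‖(1+X)⁻¹‖ ≤ (1−ε)⁻¹` (`Y = 1 − XY`, so `‖Y‖ ≤ 1 + ε‖Y‖`). [folklore] -/
theorem norm_inv_one_add_le {X : Matrix n n 𝕜} {ε : ℝ} (hX : ‖X‖ ≤ ε) (hε : ε < 1) : ‖(1 + X)⁻¹‖ ≤ (1 - ε)⁻¹ := by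
  have hunit := isUnit_one_add_of_norm_lt_one (lt_of_le_of_lt hX hε)
  set Y := (1 + X)⁻¹ with hY
  have h1 : (1 + X) * Y = 1 := Matrix.mul_nonsing_inv _ ((Matrix.isUnit_iff_isUnit_det _).mp hunit)
  have hYeq : Y = 1 - X * Y := by
    have : Y + X * Y = 1 := by rw [← h1, Matrix.add_mul, Matrix.one_mul]
    rw [← this]; abel
  have hn : ‖Y‖ ≤ 1 + ε * ‖Y‖ := by
    calc ‖Y‖ = ‖1 - X * Y‖ := by rw [← hYeq]
      _ ≤ ‖(1 : Matrix n n 𝕜)‖ + ‖X * Y‖ := norm_sub_le _ _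
      _ ≤ 1 + ‖X‖ * ‖Y‖ := add_le_add (by rw [Matrix.cstar_norm_def, map_one]; exact ContinuousLinearMap.norm_id_le) (norm_mul_le _ _)
      _ ≤ 1 + ε * ‖Y‖ := by gcongr
  rw [inv_eq_one_div, le_div_iff₀ (by linarith)]
  nlinarith [norm_nonneg Y]

variable {a u : Matrix n n 𝕜} (ha : a ∈ Matrix.unitaryGroup n 𝕜) {ε : ℝ} (hu : ‖u - a‖ ≤ ε) (hε : ε < 1)
include ha hu hε

omit hε in
/-- The slice coordinates: `X = aᴴ(u − a)` has `‖X‖ ≤ ε` and `u = a(1 + X)`. [folklore] -/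
theorem slice_coord : ‖aᴴ * (u - a)‖ ≤ ε ∧ u = a * (1 + aᴴ * (u - a)) := by
  have haa : a * aᴴ = 1 := by simpa only [star_eq_conjTranspose] using Matrix.mem_unitaryGroup_iff.mp ha
  refine ⟨?_, ?_⟩
  · calc ‖aᴴ * (u - a)‖ ≤ ‖aᴴ‖ * ‖u - a‖ := norm_mul_le _ _
      _ ≤ 1 * ε := by rw [Matrix.l2_opNorm_conjTranspose]; exact mul_le_mul (l2_opNorm_of_mem_unitaryGroup_le ha) hu (norm_nonneg _) zero_le_one
      _ = ε := one_mul ε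
  · rw [Matrix.mul_add, Matrix.mul_one, ← Matrix.mul_assoc, haa, Matrix.one_mul, add_sub_cancel]

/-- ★ **A FIELD NEAR A UNITARY FIELD IS INVERTIBLE**: `‖u − a‖ ≤ ε < 1`, `a` unitary ⟹ `u` is a unit (print's `Gᶜ`-valued configurations near `G`).
[cite: Balaban1985BackgroundPropagators, §3.B p.399 l.37–40] -/
theorem isUnit_of_near_unitary : IsUnit u := by
  obtain ⟨hX, hu'⟩ := slice_coord ha hu
  have haunit : IsUnit a := by
    have h1 : aᴴ * a = 1 := by simpa only [star_eq_conjTranspose] using Matrix.mem_unitaryGroup_iff'.mp ha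
    have h2 : a * aᴴ = 1 := by simpa only [star_eq_conjTranspose] using Matrix.mem_unitaryGroup_iff.mp ha
    exact ⟨⟨a, aᴴ, h2, h1⟩, rfl⟩
  rw [hu']
  exact haunit.mul (isUnit_one_add_of_norm_lt_one (lt_of_le_of_lt hX hε))

omit hε in
/-- The inverse in slice coordinates: `u⁻¹ = (1+X)⁻¹aᴴ`. [folklore] -/
theorem inv_eq_slice : u⁻¹ = (1 + aᴴ * (u - a))⁻¹ * aᴴ := by
  obtain ⟨_, hu'⟩ := slice_coord ha hu
  have h1 : aᴴ * a = 1 := by simpa only [star_eq_conjTranspose] using Matrix.mem_unitaryGroup_iff'.mp ha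
  conv_lhs => rw [hu']
  rw [Matrix.mul_inv_rev, Matrix.inv_eq_left_inv h1]

/-- ★★ **THE INVERSE STAYS NEAR THE ADJOINT**: `‖u⁻¹ − aᴴ‖ ≤ ε∕(1−ε)` (`u⁻¹ − aᴴ = (Y − 1)aᴴ = −XYaᴴ`). [cite: Balaban1985BackgroundPropagators, §3.B p.399 l.37–40, (3.50) p.400] -/
theorem norm_inv_sub_conjTranspose_le_of_near_unitary : ‖u⁻¹ - aᴴ‖ ≤ ε / (1 - ε) := by
  obtain ⟨hX, hu'⟩ := slice_coord ha hu
  set X := aᴴ * (u - a) with hXdef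
  have hunit := isUnit_one_add_of_norm_lt_one (lt_of_le_of_lt hX hε)
  set Y := (1 + X)⁻¹ with hY
  have h1 : (1 + X) * Y = 1 := Matrix.mul_nonsing_inv _ ((Matrix.isUnit_iff_isUnit_det _).mp hunit)
  have hY1 : Y - 1 = -(X * Y) := by
    have : Y + X * Y = 1 := by rw [← h1, Matrix.add_mul, Matrix.one_mul]
    rw [← this]; abel
  have hε0 : 0 ≤ ε := (norm_nonneg _).trans hu
  have hYn : ‖Y‖ ≤ (1 - ε)⁻¹ := norm_inv_one_add_le hX hε
  rw [inv_eq_slice ha hu, ← hXdef, ← hY]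
  have e : Y * aᴴ - aᴴ = (Y - 1) * aᴴ := by rw [Matrix.sub_mul, Matrix.one_mul]
  rw [e, hY1, Matrix.neg_mul, norm_neg]
  calc ‖X * Y * aᴴ‖ ≤ ‖X‖ * ‖Y‖ * ‖aᴴ‖ := (norm_mul_le _ _).trans (mul_le_mul_of_nonneg_right (norm_mul_le _ _) (norm_nonneg _))
    _ ≤ ε * (1 - ε)⁻¹ * 1 := by
        rw [Matrix.l2_opNorm_conjTranspose]
        exact mul_le_mul (mul_le_mul hX hYn (norm_nonneg _) hε0) (l2_opNorm_of_mem_unitaryGroup_le ha) (norm_nonneg _) (by positivity)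
    _ = ε / (1 - ε) := by rw [mul_one, div_eq_mul_inv]

/-- ★★★ **THE SLICE DEFECT IS SECOND ORDER**: `‖(u − a)aᴴ + a(u⁻¹ − aᴴ)‖ ≤ ε²∕(1−ε)` — in slice coordinates `(u−a)aᴴ + a(u⁻¹−aᴴ) = a(X + (Y − 1))aᴴ = aX(1 − Y)aᴴ = aX²Yaᴴ`:
THE FIRST-ORDER TERMS CANCEL on print's slice `V = U⁻¹` (two-sided: `2ε`; unitary slice: `ε²`, PART Ϩ-c). [cite: Balaban1985BackgroundPropagators, §3.B p.399 l.37–40, Thm 3.4 p.400, (3.48)–(3.53) pp.398–400] -/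
theorem norm_slice_zeroth_le : ‖(u - a) * aᴴ + a * (u⁻¹ - aᴴ)‖ ≤ ε ^ 2 / (1 - ε) := by
  obtain ⟨hX, hu'⟩ := slice_coord ha hu
  set X := aᴴ * (u - a) with hXdef
  have hunit := isUnit_one_add_of_norm_lt_one (lt_of_le_of_lt hX hε)
  set Y := (1 + X)⁻¹ with hY
  have h1 : (1 + X) * Y = 1 := Matrix.mul_nonsing_inv _ ((Matrix.isUnit_iff_isUnit_det _).mp hunit)
  have hY1 : 1 - Y = X * Y := by
    have : Y + X * Y = 1 := by rw [← h1, Matrix.add_mul, Matrix.one_mul]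
    rw [← this]; abel
  have haa : a * aᴴ = 1 := by simpa only [star_eq_conjTranspose] using Matrix.mem_unitaryGroup_iff.mp ha
  have hε0 : 0 ≤ ε := (norm_nonneg _).trans hu
  have hYn : ‖Y‖ ≤ (1 - ε)⁻¹ := norm_inv_one_add_le hX hε
  -- the identity
  have hid : (u - a) * aᴴ + a * (u⁻¹ - aᴴ) = a * (X * (X * Y)) * aᴴ := by
    have e1 : (u - a) * aᴴ = a * X * aᴴ := by rw [hXdef, ← Matrix.mul_assoc, haa, Matrix.one_mul]
    have r1 : X * (X * Y) = X + Y - 1 := by rw [← hY1, Matrix.mul_sub, Matrix.mul_one, ← hY1]; abel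
    rw [inv_eq_slice ha hu, ← hXdef, ← hY, e1, r1]
    noncomm_ring
  rw [hid]
  have ha1 : ‖a‖ ≤ 1 := l2_opNorm_of_mem_unitaryGroup_le ha
  have ha1' : ‖aᴴ‖ ≤ 1 := by rw [Matrix.l2_opNorm_conjTranspose]; exact ha1
  calc ‖a * (X * (X * Y)) * aᴴ‖ ≤ ‖a‖ * (‖X‖ * (‖X‖ * ‖Y‖)) * ‖aᴴ‖ := by
        refine (norm_mul_le _ _).trans (mul_le_mul ((norm_mul_le _ _).trans (mul_le_mul_of_nonneg_left
          ((norm_mul_le _ _).trans (mul_le_mul_of_nonneg_left (norm_mul_le _ _) (norm_nonneg _))) (norm_nonneg _))) le_rfl (norm_nonneg _) ?_)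
        positivity
    _ ≤ 1 * (ε * (ε * (1 - ε)⁻¹)) * 1 := by
        refine mul_le_mul (mul_le_mul ha1 (mul_le_mul hX (mul_le_mul hX hYn (norm_nonneg _) hε0) (by positivity) hε0) (by positivity) zero_le_one) ha1' (norm_nonneg _) (by positivity)
    _ = ε ^ 2 / (1 - ε) := by rw [one_mul, mul_one, div_eq_mul_inv]; ring

end OneBond

/-! ## §2 Fields: `(U, U⁻¹)` is `(2ε, 2ε²)`-near `U₀` -/

section Fields

variable {d : ℕ} {L : ℕ} [NeZero L] (M : Fin (d + 1) → ℕ) [hM : ∀ μ, NeZero (M μ)]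
variable {U₀ U : Tor (fine L M) × Fin (d + 1) → Matrix n n 𝕜} (hU₀ : ∀ bd, U₀ bd ∈ Matrix.unitaryGroup n 𝕜) {ε : ℝ} (hU : ∀ bd, ‖U bd - U₀ bd‖ ≤ ε) (hε : ε ≤ 1 / 2)
include hU₀ hU hε

omit [NeZero L] hM hU₀ hε in
/-- `‖U_b − U₀_b‖ ≤ 2ε` (trivially). [folklore] -/
theorem slice_near_fwd (bd : Tor (fine L M) × Fin (d + 1)) : ‖U bd - U₀ bd‖ ≤ 2 * ε := by
  have hε0 : 0 ≤ ε := (norm_nonneg _).trans (hU bd)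
  linarith [hU bd]

omit [NeZero L] hM in
/-- ★ `‖U_b⁻¹ − U₀_bᴴ‖ ≤ 2ε`. [cite: Balaban1985BackgroundPropagators, §3.B p.399 l.37–40] -/
theorem slice_near_bwd (bd : Tor (fine L M) × Fin (d + 1)) : ‖(fun bd => (U bd)⁻¹) bd - (U₀ bd)ᴴ‖ ≤ 2 * ε := by
  have hε0 : 0 ≤ ε := (norm_nonneg _).trans (hU bd)
  have h := norm_inv_sub_conjTranspose_le_of_near_unitary (hU₀ bd) (hU bd) (by linarith)
  refine h.trans ?_
  rw [div_le_iff₀ (by linarith)]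
  nlinarith

omit [NeZero L] hM in
/-- ★★ **THE SLICE DEFECT OF A FIELD**: `‖(U_b − U₀_b)U₀_bᴴ + U₀_b(U_b⁻¹ − U₀_bᴴ)‖ ≤ 2ε²`. [cite: Balaban1985BackgroundPropagators, §3.B p.399 l.37–40, (3.48)–(3.53) pp.398–400] -/
theorem slice_near_zeroth (bd : Tor (fine L M) × Fin (d + 1)) : ‖(U bd - U₀ bd) * (U₀ bd)ᴴ + U₀ bd * ((fun bd => (U bd)⁻¹) bd - (U₀ bd)ᴴ)‖ ≤ 2 * ε ^ 2 := by
  have hε0 : 0 ≤ ε := (norm_nonneg _).trans (hU bd)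
  have h := norm_slice_zeroth_le (hU₀ bd) (hU bd) (by linarith)
  refine h.trans ?_
  rw [div_le_iff₀ (by linarith)]
  nlinarith [sq_nonneg ε]

end Fields

/-! ## §3 King's scaling on the slice: budgets in `s = Lε` -/

section King

variable {d : ℕ} {L : ℕ} [NeZero L] (T : BlockTree d L) (M : Fin (d + 1) → ℕ) [hM : ∀ μ, NeZero (M μ)]
variable {D : ℕ} (hD : ∀ j, T.depth j ≤ D)
variable {a m2 : ℝ} (ha : 0 ≤ a) (hm : 0 ≤ m2) (hL : 1 ≤ L)
variable {U₀ : Tor (fine L M) × Fin (d + 1) → Matrix n n 𝕜} (hU₀ : ∀ bd, U₀ bd ∈ Matrix.unitaryGroup n 𝕜)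
variable {κ : ℝ} (hκ : 0 < κ) (hcoer : ∀ v : Tor (fine L M) × n → 𝕜, κ * ∑ x, ‖fib (fine L M) v x‖ ^ 2 ≤ RCLike.re (star v ⬝ᵥ (fullOpU T M a ((L : ℝ) ^ 2) m2 U₀ *ᵥ v)))
variable {U : Tor (fine L M) × Fin (d + 1) → Matrix n n 𝕜} {ε : ℝ} (hU : ∀ bd, ‖U bd - U₀ bd‖ ≤ ε) (hε : ε ≤ 1 / 2)
include hD ha hm hL hU₀ hκ hcoer hU hε

omit hκ in
/-- ★★★ **THE COERCIVITY CONSTANT ON THE SLICE**: `(κ∕2 − 10(d+1)(Lε)² − a((1+2ε)^{2D} − 1))·Σ‖ω_x‖² ≤ Re⟨ω, A(U,U⁻¹)ω⟩` (`c = L²`; the budget is a function of `s = Lε`).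
[cite: Balaban1985BackgroundPropagators, Thm 3.4 p.400, (3.48)–(3.53) pp.398–400] -/
theorem re_quadForm_cxFullOp_slice_ge (ω : Tor (fine L M) × n → 𝕜) :
    (κ / 2 - 10 * ((d : ℝ) + 1) * ((L : ℝ) * ε) ^ 2 - a * ((1 + 2 * ε) ^ (2 * D) - 1)) * ∑ x, ‖fib (fine L M) ω x‖ ^ 2
      ≤ RCLike.re (star ω ⬝ᵥ (cxFullOp T M a ((L : ℝ) ^ 2) m2 U (fun bd => (U bd)⁻¹) *ᵥ ω)) := by
  have hε0 : 0 ≤ ε := (norm_nonneg _).trans (hU (0, 0))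
  have h := re_quadForm_cxFullOp_ge T M hD ha (by positivity) hm hU₀ hcoer (by linarith) (slice_near_fwd M hU) (slice_near_bwd M hU₀ hU hε) (slice_near_zeroth M hU₀ hU hε) ω
  have e : (L : ℝ) ^ 2 * ((d : ℝ) + 1) * (2 * ε ^ 2 + 2 * (2 * ε) ^ 2) = 10 * ((d : ℝ) + 1) * ((L : ℝ) * ε) ^ 2 := by ring
  rw [e] at h
  exact h

/-- ★★★ **INVERTIBILITY ON THE SLICE**: `10(d+1)s² + a((1+2ε)^{2D} − 1) ≤ κ∕4` (`s = Lε`) ⟹ `A(U,U⁻¹)` is invertible. [cite: Balaban1985BackgroundPropagators, Thm 3.4 p.400] -/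
theorem isUnit_cxFullOp_slice (hwin : 10 * ((d : ℝ) + 1) * ((L : ℝ) * ε) ^ 2 + a * ((1 + 2 * ε) ^ (2 * D) - 1) ≤ κ / 4) :
    IsUnit (cxFullOp T M a ((L : ℝ) ^ 2) m2 U (fun bd => (U bd)⁻¹)) := by
  have hε0 : 0 ≤ ε := (norm_nonneg _).trans (hU (0, 0))
  refine isUnit_cxFullOp_king_of_near T M hD ha hm hL hU₀ hκ hcoer (by linarith) (slice_near_fwd M hU) (slice_near_bwd M hU₀ hU hε) (slice_near_zeroth M hU₀ hU hε) ?_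
  nlinarith

/-- ★★★ **THE NORM OF `G(U,U⁻¹)` ON THE SLICE**: the same budget ⟹ `‖G(U,U⁻¹)‖ ≤ 4∕κ`. [cite: Balaban1985BackgroundPropagators, Thm 3.4 p.400, (3.46) p.398 (shape)] -/
theorem l2_opNorm_cxFullOp_inv_slice_le (hwin : 10 * ((d : ℝ) + 1) * ((L : ℝ) * ε) ^ 2 + a * ((1 + 2 * ε) ^ (2 * D) - 1) ≤ κ / 4) :
    ‖(cxFullOp T M a ((L : ℝ) ^ 2) m2 U (fun bd => (U bd)⁻¹))⁻¹‖ ≤ 4 / κ := by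
  have hε0 : 0 ≤ ε := (norm_nonneg _).trans (hU (0, 0))
  refine l2_opNorm_cxFullOp_inv_le_king_of_near T M hD ha hm hL hU₀ hκ hcoer (by linarith) (slice_near_fwd M hU) (slice_near_bwd M hU₀ hU hε) (slice_near_zeroth M hU₀ hU hε) ?_
  nlinarith

/-- ★★★★ **EXPONENTIAL DECAY ON PRINT's SLICE, BAŁABAN's SCALE**: `(d+1)(e(2s² + 4s) + 8e²s²) + e·a((1+2ε)^{2D} − 1) ≤ κ∕8` (`s = Lε`) ⟹
`‖blk G(U,U⁻¹) x y‖ ≤ (8∕κ)·e^{−ctRate(κ∕2,a,d)·d(x,y)∕L}` for all sites, every volume, every fibre — «the extended operators satisfy all the inequalities of Theorem 3.1» in King's model.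
[cite: Balaban1985BackgroundPropagators, Thm 3.4 p.400, (3.39) p.397; King1986, (4.33) p.674; Dimock2013, App. D, Lemma 30] -/
theorem norm_blk_cxFullOp_inv_slice_le
    (hwin : ((d : ℝ) + 1) * (Real.exp 1 * (2 * ((L : ℝ) * ε) ^ 2 + 4 * ((L : ℝ) * ε)) + 8 * Real.exp 1 ^ 2 * ((L : ℝ) * ε) ^ 2) + Real.exp 1 * (a * ((1 + 2 * ε) ^ (2 * D) - 1)) ≤ κ / 8)
    (x y : Tor (fine L M)) :
    ‖blk (cxFullOp T M a ((L : ℝ) ^ 2) m2 U (fun bd => (U bd)⁻¹))⁻¹ x y‖ ≤ 8 / κ * Real.exp (-(ctRate (κ / 2) a d / L * tdistT (fine L M) x y)) := by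
  have hε0 : 0 ≤ ε := (norm_nonneg _).trans (hU (0, 0))
  refine norm_blk_cxFullOp_inv_le_king_of_near T M hD ha hm hL hU₀ hκ hcoer (by linarith) (slice_near_fwd M hU) (slice_near_bwd M hU₀ hU hε) (slice_near_zeroth M hU₀ hU hε)
    (by positivity) ?_ x y
  have e : ((d : ℝ) + 1) * (Real.exp 1 * ((L : ℝ) ^ 2 * (2 * ε ^ 2) + 2 * ((L : ℝ) * (2 * ε))) + 2 * Real.exp 1 ^ 2 * ((L : ℝ) * (2 * ε)) ^ 2)
      = ((d : ℝ) + 1) * (Real.exp 1 * (2 * ((L : ℝ) * ε) ^ 2 + 4 * ((L : ℝ) * ε)) + 8 * Real.exp 1 ^ 2 * ((L : ℝ) * ε) ^ 2) := by ring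
  rw [e]
  exact hwin

end King

/-! ## §4 For comparison: the two-sided family, and the unitary slice (coercivity is open) -/

section Comparison

variable {d : ℕ} {L : ℕ} [NeZero L] (T : BlockTree d L) (M : Fin (d + 1) → ℕ) [hM : ∀ μ, NeZero (M μ)]
variable {D : ℕ} (hD : ∀ j, T.depth j ≤ D)
variable {a m2 : ℝ} (ha : 0 ≤ a) (hm : 0 ≤ m2) (hL : 1 ≤ L)
variable {U₀ : Tor (fine L M) × Fin (d + 1) → Matrix n n 𝕜} (hU₀ : ∀ bd, U₀ bd ∈ Matrix.unitaryGroup n 𝕜)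
variable {κ : ℝ} (hκ : 0 < κ) (hcoer : ∀ v : Tor (fine L M) × n → 𝕜, κ * ∑ x, ‖fib (fine L M) v x‖ ^ 2 ≤ RCLike.re (star v ⬝ᵥ (fullOpU T M a ((L : ℝ) ^ 2) m2 U₀ *ᵥ v)))
include hD ha hm hL hU₀ hκ hcoer

/-- ★ THE TWO-SIDED FAMILY (independent `V`): `‖U_b − U₀_b‖, ‖V_b − U₀_bᴴ‖ ≤ ε` and `(d+1)(2L²ε + 2(Lε)²) + a((1+ε)^{2D} − 1) ≤ κ∕4` ⟹ `A(U,V)` invertible — a window LINEAR in `L²ε = ε∕η²`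
(PART Ϛ-d: sharp at this order for the fine layer). [cite: Balaban1985BackgroundPropagators, Thm 3.4 p.400] -/
theorem isUnit_cxFullOp_two_sided {U V : Tor (fine L M) × Fin (d + 1) → Matrix n n 𝕜} {ε : ℝ} (hε0 : 0 ≤ ε) (hU : ∀ bd, ‖U bd - U₀ bd‖ ≤ ε) (hV : ∀ bd, ‖V bd - (U₀ bd)ᴴ‖ ≤ ε)
    (hwin : ((d : ℝ) + 1) * (2 * (L : ℝ) ^ 2 * ε + 2 * ((L : ℝ) * ε) ^ 2) + a * ((1 + ε) ^ (2 * D) - 1) ≤ κ / 4) :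
    IsUnit (cxFullOp T M a ((L : ℝ) ^ 2) m2 U V) := by
  have h0 : ∀ bd, ‖(U bd - U₀ bd) * (U₀ bd)ᴴ + U₀ bd * (V bd - (U₀ bd)ᴴ)‖ ≤ 2 * ε := fun bd =>
    (norm_zeroth_two_sided_le (hU₀ bd) _ _).trans (by linarith [hU bd, hV bd])
  refine isUnit_cxFullOp_king_of_near T M hD ha hm hL hU₀ hκ hcoer hε0 hU hV h0 ?_
  nlinarith

omit hκ in
/-- ★★ **COERCIVITY IS AN OPEN CONDITION ON BAŁABAN's SCALE** (the unitary slice): for a UNITARY `U` with `‖U_b − U₀_b‖ ≤ ε` on every bond,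
`(κ∕2 − 3(d+1)(Lε)² − a((1+ε)^{2D} − 1))·Σ‖ω_x‖² ≤ Re⟨ω, A₀(U)ω⟩` — a `κ`-coercive `A₀(U₀)` makes `A₀(U)` coercive on the whole `s₀η`-neighbourhood (Ϩ-c `zeroth_unitary_slice`: defect `ε²`).
[cite: Balaban1985BackgroundPropagators, Thm 3.1 p.397, (3.48) p.398] -/
theorem re_quadForm_fullOpU_ge_of_near_unitary {U : Tor (fine L M) × Fin (d + 1) → Matrix n n 𝕜} (hUu : ∀ bd, U bd ∈ Matrix.unitaryGroup n 𝕜) {ε : ℝ} (hε0 : 0 ≤ ε)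
    (hU : ∀ bd, ‖U bd - U₀ bd‖ ≤ ε) (ω : Tor (fine L M) × n → 𝕜) :
    (κ / 2 - 3 * ((d : ℝ) + 1) * ((L : ℝ) * ε) ^ 2 - a * ((1 + ε) ^ (2 * D) - 1)) * ∑ x, ‖fib (fine L M) ω x‖ ^ 2
      ≤ RCLike.re (star ω ⬝ᵥ (fullOpU T M a ((L : ℝ) ^ 2) m2 U *ᵥ ω)) := by
  have hV : ∀ bd, ‖(fun bd => (U bd)ᴴ) bd - (U₀ bd)ᴴ‖ ≤ ε := fun bd => by
    have : (U bd)ᴴ - (U₀ bd)ᴴ = (U bd - U₀ bd)ᴴ := by rw [conjTranspose_sub]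
    simp only []; rw [this, Matrix.l2_opNorm_conjTranspose]; exact hU bd
  have h0 : ∀ bd, ‖(U bd - U₀ bd) * (U₀ bd)ᴴ + U₀ bd * ((fun bd => (U bd)ᴴ) bd - (U₀ bd)ᴴ)‖ ≤ ε ^ 2 := fun bd => by
    have h := norm_zeroth_unitary_slice_le (hUu bd) (hU₀ bd) (hU bd)
    exact h
  have h := re_quadForm_cxFullOp_ge T M hD ha (by positivity) hm hU₀ hcoer hε0 hU hV h0 ω
  rw [cxFullOp_adjoint] at h
  have e : (L : ℝ) ^ 2 * ((d : ℝ) + 1) * (ε ^ 2 + 2 * ε ^ 2) = 3 * ((d : ℝ) + 1) * ((L : ℝ) * ε) ^ 2 := by ring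
  rw [e] at h
  exact h

end Comparison


end Summit.QuantumFields.YangMills.BalabanUVNodes.N15KingModelRung.Analytic

end
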